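import Mathlib
import Summits.KontsevichZagierPeriods.Zeta5Search.Families.CellularBrownZudilinGrowth
import Summits.KontsevichZagierPeriods.Zeta5Search.Families.CellularVanishingMiddleGrowth
import Summits.KontsevichZagierPeriods.Zeta5Search.Families.BasicGrowthFive
import HarnessLib

/-!
# ζ(5) search — Families: two gap-disjoint matchings halve the growth constant once per edge — `M_σ ≤ 2^{−(ℓ+1)}`

HONEST FRAMING: systematic search; no irrationality claim unless certified.  STRUCTURAL facts about the size of Brown's
basic cellular integrals [Brown2016, §1.5 (1.3)] (seat P2, Families layer); nothing arithmetic.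

`Families/BasicGrowthBounds.lean` proved `f_σ ≤ 1/2` from ONE Hall matching of the finite `σδ⁰`-edges to the gaps.
Here: if the finite edges admit TWO bijective systems of distinct gap representatives `m₁, m₂` (each edge receives a gap
of its own span, the two gaps of every edge distinct — a `2`-factor of the edge/gap containment graph), then
**`f_σ ≤ 2^{−(ℓ+1)}` on the open simplex** (`fSigma_le_half_pow_of_two_sdr`): `f_σ² = ∏_e g_{m₁e}g_{m₂e}/len_e²` and
`4 g_{m₁e} g_{m₂e} ≤ (g_{m₁e}+g_{m₂e})² ≤ len_e²`.  The hypothesis is a finite, decidable property of the seating; it is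
discharged by `decide` with explicit witnesses for the named configurations, giving
* `fSup_sigma5_le` (`M_{₅π} ≤ 1/8`; exact value `φ⁻⁵ ≈ 0.0902`, `Families/BasicGrowthFive.lean`), `fSup_sigma6_le`
  (`M ≤ 1/16` for Brown's `N = 6` plan; numerically `(√2−1)⁴ ≈ 0.0294`), **`fSup_pi8dual_le` / `bzSup_one_le`**
  (`M_{₈π₈^∨} ≤ 1/64`; numerically `0.005004 = |λ₂|` of [BrownZudilin2022, §2]), **`vimSup_le`** (`≤ 1/256`);
* hence **`cellularIntegral_symmetric_le`** (`I(n,…,n) ≤ 64^{−n} I(0,…,0)` for the Brown–Zudilin totally symmetric integrals)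
  and **`vimIntegral_le_pow`** (`I_n ≤ 256^{−n} I_0` for the VIM integrals of [BrownZudilin2022, §12]).
EVIDENCE for the general statement (NOT claimed): every convergent seating with `n ≤ 9` (3,318 seatings with `σ₀ = 0`,
all value rotations included) admits such a `2`-factor (exhaustive max-flow check, `HOME/pub-zeta5-p2/g4/twofactor.py`),
so `M_σ ≤ 2^{−(n−2)}` for all of them; whether every convergent seating does is OPEN here.  Standard axioms only.
-/

noncomputable section

open MeasureTheory Set Finset Filter Topology

namespace Summit.KontsevichZagierPeriods.Zeta5Search.Families.Cellular

open Literature.NumberTheory.Irrationality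

variable {ℓ : ℕ} (σ : Fin (ℓ + 3) → Fin (ℓ + 3))

/-! ### The two-matching bound -/

/-- **Two gap-disjoint matchings give `f_σ ≤ 2^{−(ℓ+1)}`.**  If `m₁, m₂` are bijections from the finite `σδ⁰`-edges
to the gaps with `m₁ e, m₂ e ∈ span(e)` and `m₁ e ≠ m₂ e` for every edge, then `f_σ(t) ≤ (1/2)^{ℓ+1}` on the open
simplex. -/
theorem fSigma_le_half_pow_of_two_sdr (hσ : Function.Bijective σ) (m₁ m₂ : SEdge σ → Fin (ℓ + 1))
    (hb₁ : Function.Bijective m₁) (hb₂ : Function.Bijective m₂)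
    (hs₁ : ∀ i, m₁ i ∈ (cellEdges σ hσ.1).span (Sum.inr i)) (hs₂ : ∀ i, m₂ i ∈ (cellEdges σ hσ.1).span (Sum.inr i))
    (hne : ∀ i, m₁ i ≠ m₂ i) {t : Fin ℓ → ℝ} (ht : t ∈ openSimplex ℓ) :
    fSigma σ t ≤ (1 / 2) ^ (ℓ + 1) := by
  classical
  have hpos := (mem_openSimplex_iff_gapN t).1 ht
  set E := cellEdges σ hσ.1 with hE
  have hlen : ∀ i : SEdge σ, 0 < E.len t (Sum.inr i) := fun i => E.len_pos ht _
  have hden : 0 < formDen σ t := Finset.prod_pos fun i _ => ef_pos ht fun h => succ_ne_self i (hσ.1 h)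
  -- `f = P / L` with `P = ∏ gaps`, `L = ∏ len`
  have hP1 : ∏ w : Fin (ℓ + 1), gapN t w = ∏ i : SEdge σ, gapN t (m₁ i) :=
    (Equiv.prod_comp (Equiv.ofBijective m₁ hb₁) (fun w => gapN t w)).symm
  have hP2 : ∏ w : Fin (ℓ + 1), gapN t w = ∏ i : SEdge σ, gapN t (m₂ i) :=
    (Equiv.prod_comp (Equiv.ofBijective m₂ hb₂) (fun w => gapN t w)).symm
  have hL : 0 < ∏ i : SEdge σ, E.len t (Sum.inr i) := Finset.prod_pos fun i _ => hlen i
  unfold fSigma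
  rw [prod_ef_succ_eq_prod_gapN, formDen_eq_prod_len σ hσ ht, div_le_iff₀ hL]
  -- compare squares
  have hPnn : 0 ≤ ∏ w : Fin (ℓ + 1), gapN t w := Finset.prod_nonneg fun w _ => (hpos w).le
  have hRnn : 0 ≤ (1 / 2 : ℝ) ^ (ℓ + 1) * ∏ i : SEdge σ, E.len t (Sum.inr i) := by positivity
  rw [← pow_le_pow_iff_left₀ hPnn hRnn two_ne_zero]
  -- `P² = ∏_e g(m₁ e) g(m₂ e)` and `(c L)² = ∏_e len_e² / 4`
  have hsq : (∏ w : Fin (ℓ + 1), gapN t w) ^ 2 = ∏ i : SEdge σ, (gapN t (m₁ i) * gapN t (m₂ i)) := by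
    rw [sq, Finset.prod_mul_distrib, ← hP1, ← hP2]
  have hcard : (Finset.univ : Finset (SEdge σ)).card = ℓ + 1 := by rw [Finset.card_univ, card_sEdge σ hσ]
  have hsq' : ((1 / 2 : ℝ) ^ (ℓ + 1) * ∏ i : SEdge σ, E.len t (Sum.inr i)) ^ 2 =
      ∏ i : SEdge σ, (E.len t (Sum.inr i) ^ 2 / 4) := by
    rw [mul_pow, ← pow_mul, mul_comm (ℓ + 1) 2, pow_mul, ← Finset.prod_pow, Finset.prod_div_distrib,
      Finset.prod_const, hcard]
    have h14 : ((1 / 2 : ℝ) ^ 2) = 1 / 4 := by norm_num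
    rw [h14, one_div_pow, one_div_mul_eq_div]
  rw [hsq, hsq']
  refine Finset.prod_le_prod (fun i _ => (mul_pos (hpos _) (hpos _)).le) fun i _ => ?_
  -- `4 g₁ g₂ ≤ (g₁ + g₂)² ≤ len²`
  have hsum : gapN t (m₁ i) + gapN t (m₂ i) ≤ E.len t (Sum.inr i) := by
    rw [E.len_eq_sum_gap]
    have hpair : ({m₁ i, m₂ i} : Finset (Fin (ℓ + 1))) ⊆ E.span (Sum.inr i) := by
      intro x hx
      rw [Finset.mem_insert, Finset.mem_singleton] at hx
      rcases hx with rfl | rfl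
      · exact hs₁ i
      · exact hs₂ i
    have h2 : ∑ x ∈ ({m₁ i, m₂ i} : Finset (Fin (ℓ + 1))), gapN t x ≤ ∑ x ∈ E.span (Sum.inr i), gapN t x :=
      Finset.sum_le_sum_of_subset_of_nonneg hpair fun x _ _ => (hpos x).le
    rwa [Finset.sum_pair (hne i)] at h2
  have h1 := (hpos (m₁ i)).le
  have h2 := (hpos (m₂ i)).le
  nlinarith [sq_nonneg (gapN t (m₁ i) - gapN t (m₂ i)), mul_self_le_mul_self (by linarith) hsum]

/-- The growth constant under the two-matching hypothesis: `M_σ ≤ 2^{−(ℓ+1)}`. -/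
theorem fSup_le_half_pow_of_two_sdr (hσ : Function.Bijective σ) (m₁ m₂ : SEdge σ → Fin (ℓ + 1))
    (hb₁ : Function.Bijective m₁) (hb₂ : Function.Bijective m₂)
    (hs₁ : ∀ i, m₁ i ∈ (cellEdges σ hσ.1).span (Sum.inr i)) (hs₂ : ∀ i, m₂ i ∈ (cellEdges σ hσ.1).span (Sum.inr i))
    (hne : ∀ i, m₁ i ≠ m₂ i) : fSup σ ≤ (1 / 2) ^ (ℓ + 1) :=
  fSup_le_of_forall_le σ fun _ ht => fSigma_le_half_pow_of_two_sdr σ hσ m₁ m₂ hb₁ hb₂ hs₁ hs₂ hne ht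

/-- The basic integrals under the two-matching hypothesis: `I_σ(N) ≤ 2^{−(ℓ+1)N} I_σ(0)`. -/
theorem integral_basic_le_of_two_sdr (hσ : Function.Bijective σ) (m₁ m₂ : SEdge σ → Fin (ℓ + 1))
    (hb₁ : Function.Bijective m₁) (hb₂ : Function.Bijective m₂)
    (hs₁ : ∀ i, m₁ i ∈ (cellEdges σ hσ.1).span (Sum.inr i)) (hs₂ : ∀ i, m₂ i ∈ (cellEdges σ hσ.1).span (Sum.inr i))
    (hne : ∀ i, m₁ i ≠ m₂ i) (N : ℕ) :
    integral σ (fun _ => (N : ℤ)) (fun _ => (N : ℤ)) ≤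
      ((1 / 2) ^ (ℓ + 1)) ^ N * integral σ (fun _ => (0 : ℤ)) (fun _ => (0 : ℤ)) :=
  (integral_basic_le_fSup_pow σ hσ N).trans (mul_le_mul_of_nonneg_right
    (pow_le_pow_left₀ (fSup_pos σ hσ).le (fSup_le_half_pow_of_two_sdr σ hσ m₁ m₂ hb₁ hb₂ hs₁ hs₂ hne) N)
    (integral_nonneg hσ.1 _ _))

/-! ### Named configurations: witnesses by `decide` -/

/-- `₅π`: `M ≤ 1/8` (the exact value is `φ⁻⁵ ≈ 0.0902`, `fSup_sigma5`). -/
theorem fSup_sigma5_le : fSup sigma5 ≤ (1 / 2) ^ 3 :=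
  fSup_le_half_pow_of_two_sdr sigma5 sigma5_bijective
    (fun i => (![0, 1, 2, 0, 0] : Fin 5 → Fin 3) i.1) (fun i => (![0, 2, 0, 1, 0] : Fin 5 → Fin 3) i.1)
    (by decide) (by decide) (by decide) (by decide) (by decide)

/-- `sigma6` is a bijection of `Fin 6`. -/
theorem sigma6_bijective : Function.Bijective sigma6 := Finite.injective_iff_bijective.1 sigma6_eq_ofSeating.2.1

/-- Brown's `N = 6` plan `(1,4,2,6,3,5)`: `M ≤ 1/16` (numerically `M = (√2−1)⁴ ≈ 0.0294`, Apéry's constant; not proved). -/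
theorem fSup_sigma6_le : fSup sigma6 ≤ (1 / 2) ^ 4 :=
  fSup_le_half_pow_of_two_sdr sigma6 sigma6_bijective
    (fun i => (![0, 1, 0, 0, 2, 3] : Fin 6 → Fin 4) i.1) (fun i => (![1, 2, 0, 0, 3, 0] : Fin 6 → Fin 4) i.1)
    (by decide) (by decide) (by decide) (by decide) (by decide)

/-- **`₈π₈^∨` (Brown–Zudilin): `M ≤ 1/64`** (numerically `M = 0.005004… = |λ₂|`, [BrownZudilin2022, §2]; not proved). -/
theorem fSup_pi8dual_le : fSup pi8dual ≤ (1 / 2) ^ 6 :=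
  fSup_le_half_pow_of_two_sdr pi8dual pi8dual_bijective
    (fun i => (![0, 1, 0, 5, 4, 2, 3, 0] : Fin 8 → Fin 6) i.1) (fun i => (![0, 2, 1, 0, 5, 3, 4, 0] : Fin 8 → Fin 6) i.1)
    (by decide) (by decide) (by decide) (by decide) (by decide)

/-- `bzSup (1,…,1) ≤ 1/64`. -/
theorem bzSup_one_le : bzSup (fun _ => (1 : ℤ)) ≤ (1 / 2) ^ 6 := by
  rw [bzSup_one]
  exact fSup_pi8dual_le

/-- **The Brown–Zudilin totally symmetric integrals decay at least like `64^{−n}`**: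
`I(n,…,n) ≤ (1/64)^n · I(0,…,0)`. [BrownZudilin2022, §2 objects; structural] -/
theorem cellularIntegral_symmetric_le (n : ℕ) :
    BrownZudilin2022.cellularIntegral (fun _ => (n : ℤ)) ≤
      ((1 / 2) ^ 6) ^ n * BrownZudilin2022.cellularIntegral (fun _ => (0 : ℤ)) := by
  have h := integral_basic_le_of_two_sdr pi8dual pi8dual_bijective
    (fun i => (![0, 1, 0, 5, 4, 2, 3, 0] : Fin 8 → Fin 6) i.1) (fun i => (![0, 2, 1, 0, 5, 3, 4, 0] : Fin 8 → Fin 6) i.1)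
    (by decide) (by decide) (by decide) (by decide) (by decide) n
  rwa [integral_bz_symmetric, integral_bz_symmetric] at h

/-- **VIM: `vimSup ≤ 1/256`.** -/
theorem vimSup_le : vimSup ≤ (1 / 2) ^ 8 :=
  fSup_le_half_pow_of_two_sdr vim10 vim10_bijective
    (fun i => (![0, 1, 0, 2, 3, 4, 5, 7, 6, 0] : Fin 10 → Fin 8) i.1)
    (fun i => (![0, 2, 1, 0, 4, 3, 6, 5, 7, 0] : Fin 10 → Fin 8) i.1)
    (by decide) (by decide) (by decide) (by decide) (by decide)

/-- **The VIM integrals decay at least like `256^{−n}`**: `I_n ≤ (1/256)^n · I_0`. [BrownZudilin2022, §12 objects] -/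
theorem vimIntegral_le_pow (n : ℕ) :
    BrownZudilin2022.vimIntegral n ≤ ((1 / 2) ^ 8) ^ n * BrownZudilin2022.vimIntegral 0 := by
  have h := integral_basic_le_of_two_sdr vim10 vim10_bijective
    (fun i => (![0, 1, 0, 2, 3, 4, 5, 7, 6, 0] : Fin 10 → Fin 8) i.1)
    (fun i => (![0, 2, 1, 0, 4, 3, 6, 5, 7, 0] : Fin 10 → Fin 8) i.1)
    (by decide) (by decide) (by decide) (by decide) (by decide) n
  have h0 : integral vim10 (fun _ => (0 : ℤ)) (fun _ => (0 : ℤ)) = BrownZudilin2022.vimIntegral 0 := by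
    have := integral_vim 0
    rwa [Nat.cast_zero] at this
  rw [integral_vim, h0] at h
  exact h

end Summit.KontsevichZagierPeriods.Zeta5Search.Families.Cellular
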